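import Summits.ABC.ABC.Theorems.TwistAmplificationSharpModerateLawCornerFlatCalibration

/-!
# Crux `TwistAmplification.SharpModerateLaw` (stmt-ABC-1975): line `unit-plane-conic-two-torsion`,
objects of the RESHAPED skeleton v3 (no floor; Hall-proper corner; spread split by conic content)

Lead `prover-line-stmt-ABC-1975-c3-0`, cycle 1 → 2. The v2 cut (`…UnitPlaneDefs.lean`: flat part
`m♭ = coprimePart (6·g·|Disc F|) m`, Hall floor `X^{−ε/4}·m_max`) put ≥ 97 % of all shell data up to
`Mplus < 2^31` into its "corner", mislabelled two abc-hard Frey families as Hall data, and needed the floor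
only to control `v(m)/v(m♭)` (evidence `cornerLaw-analysis-c3.md`, `spreadCensus-analysis-c3.md` of the
cycle-1 wave). v3 keeps the composition idea (few-deep ∪ spread ∪ corner, the lever feeding the spread
census) and makes the labels honest:

* §1 `mflat6` (`m♭ := coprimePart 6 m`: keep EVERY prime `≥ 5`, so `v(m) ∣ 6·v(m♭)` and no floor is needed),
  the floor-free few-deep population `FewDeepFlat6`, the SCALE-FREE twist-aware Hall corner `CornerHallTw`
  (the primitive datum is Hall at its own level `2Y/g⁶`: `|Disc F|·m²·g³ ≤ 432·√(2Y)`, the image of the sibling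
  line's `HallRegimeTw` with `d ↔ g`; contains no Frey datum with `c ≥ 10⁴`), the spread population
  `SpreadFlat6 := ¬few-deep ∧ ¬Hall` split by CONIC CONTENT: `SpreadDeep6` (the LEVER's square class
  `S = sqPart (leverFlat F q) > 1`: a genuine planarity conic) and `SpreadShallow6` (`S ≤ 1`: no conic content —
  the small-radical RING census), with the cover `flat6_cover`;
* §2 generic glue for ε-indexed cone laws (`lawWithConeE_mono`, `lawWithConeE_or`, `lawWithConeE_one_of_zero`)
  and the v3 glue `flat6Cover_glue` (registered sub-goal): the four population laws ⇒ `IndexFormShellLawCone`;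
* §3 the UNIFORM lever statement `PlanarityFactorisationUniform` (shape count `≪_δ (|a|·|Disc F|·T)^δ·|Cl(O)[2]|`,
  norms `≪ |a|³|Disc F|⁵·T`, `r ≪ √|Disc F|` — the form a census can consume; the landed `PlanarityFactorisation`
  (p118877) has `F`-dependent constants) and the calibration target `StrongHallCount` of the Hall corner
  (`#{u ≤ U squarefree, (u,6)=1 : 0 < 72|u³ − v²| ≤ √u} ≪ U^ε`, strictly below the one-variable √-barrier);
* §4 the named stub statements `FewDeepFlat6Law`, `RingCensus6`, `CornerHallLaw6` and the composition
  `sharpModerateLaw_of_flat6` (uniformity ⇒ few-deep-6 ⇒ spread-deep ⇒ spread-shallow ⇒ Hall ⇒ crux).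

The spread-deep stub's hypotheses (`PlanarityFactorisationUniform`, Heath-Brown's `TernaryConicPointBound`)
are spelled in the skeleton, not here. Nothing is proved about the open populations here.
-/

noncomputable section

-- the mandated summit namespace `Summit.ABC.ABC` (summit = problem) trips the duplicate-namespace linter
set_option linter.dupNamespace false

namespace Summit.ABC.ABC.Theorems.SharpModerateLaw.UnitPlane

open Literature.NumberTheory.CubicFields
open UniqueFactorizationMonoid (radical)
open scoped BigOperators

/-! ## 1. The v3 populations -/

/-- `m♭⁶`: the part of `m = |F(u,v)|` prime to `6` (every prime `≥ 5` kept, content and ramified ones included). -/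
def mflat6 (F : BinaryCubic ℤ) (q : ℤ × ℤ) : ℕ := coprimePart 6 (primValue F q)

/-- The LEVER's flat part of the primitive value: `m` stripped of the primes of `6·a·Disc F` (the cell
`(T, S)` of `PlanarityFactorisation(Uniform)` is `(sqfreeKernel, sqPart)` of this number). -/
def leverFlat (F : BinaryCubic ℤ) (q : ℤ × ℤ) : ℕ :=
  coprimePart (6 * F.a.natAbs * F.disc.natAbs) (primValue F q)

/-- FEW-DEEP, v3 (no floor): `g · rad|Disc F| · v(m♭⁶) ≤ X·Y^{−1/6}` (Kane's cap on the 6-flat part). -/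
def FewDeepFlat6 (_ε X Y : ℝ) (F : BinaryCubic ℤ) (q : ℤ × ℤ) : Prop :=
  ((Int.gcd q.1 q.2 : ℕ) : ℝ) * ((radical F.disc.natAbs : ℕ) : ℝ) * ((depthRad (mflat6 F q) : ℕ) : ℝ) ≤
    X * Y ^ (-(1 / 6 : ℝ))

/-- HALL CORNER, v3 (scale-free, twist-aware): the primitive datum is Hall at its own level,
`|Disc F|·m²·g³ ≤ 432·√(2Y)` (`|Disc F|·g⁶·m² = |Disc F·F(q)²|` is `2⁸3⁶|Δ|` on curve data; this is the image of
the sibling's `HallRegimeTw` with twist divisor `d = g`). -/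
def CornerHallTw (_ε _X Y : ℝ) (F : BinaryCubic ℤ) (q : ℤ × ℤ) : Prop :=
  (F.disc.natAbs : ℝ) * (primValue F q : ℝ) ^ 2 * ((Int.gcd q.1 q.2 : ℕ) : ℝ) ^ 3 ≤ 432 * Real.sqrt (2 * Y)

/-- SPREAD, v3: neither few-deep nor Hall. -/
def SpreadFlat6 (ε X Y : ℝ) (F : BinaryCubic ℤ) (q : ℤ × ℤ) : Prop :=
  ¬ FewDeepFlat6 ε X Y F q ∧ ¬ CornerHallTw ε X Y F q

/-- SPREAD-DEEP, v3: spread with CONIC CONTENT — the lever's square class `S = sqPart (leverFlat F q)` exceeds `1`. -/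
def SpreadDeep6 (ε X Y : ℝ) (F : BinaryCubic ℤ) (q : ℤ × ℤ) : Prop :=
  SpreadFlat6 ε X Y F q ∧ 1 < sqPart (leverFlat F q)

/-- SPREAD-SHALLOW, v3: spread WITHOUT conic content (`S ≤ 1`): the datum is spread only because its ring/twist
is expensive (`g·rad|Disc F|` large) or its depth sits at the primes of `6·a·Disc F` — a small-radical RING census. -/
def SpreadShallow6 (ε X Y : ℝ) (F : BinaryCubic ℤ) (q : ℤ × ℤ) : Prop :=
  SpreadFlat6 ε X Y F q ∧ sqPart (leverFlat F q) ≤ 1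

/-- The four v3 populations cover every datum. -/
theorem flat6_cover (ε X Y : ℝ) (F : BinaryCubic ℤ) (q : ℤ × ℤ) :
    FewDeepFlat6 ε X Y F q ∨ SpreadDeep6 ε X Y F q ∨ SpreadShallow6 ε X Y F q ∨ CornerHallTw ε X Y F q := by
  by_cases h1 : FewDeepFlat6 ε X Y F q
  · exact Or.inl h1
  by_cases h2 : CornerHallTw ε X Y F q
  · exact Or.inr (Or.inr (Or.inr h2))
  rcases lt_or_ge 1 (sqPart (leverFlat F q)) with h | h
  · exact Or.inr (Or.inl ⟨⟨h1, h2⟩, h⟩)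
  · exact Or.inr (Or.inr (Or.inl ⟨⟨h1, h2⟩, h⟩))

/-! ## 2. Glue for ε-indexed cone laws -/

/-- Monotonicity of ε-indexed cone laws in the population (on the shell), any additive constant. -/
theorem lawWithConeE_mono {P Q : ℝ → ℝ → ℝ → BinaryCubic ℤ → ℤ × ℤ → Prop} {c : ℝ}
    (h : ∀ ε X Y F q, q ∈ ifShell F X Y → P ε X Y F q → Q ε X Y F q) (hQ : LawWithConeE Q c) :
    LawWithConeE P c := by
  intro σ hσ ε hε
  obtain ⟨C, hC⟩ := hQ σ hσ ε hε
  refine ⟨C, fun X Y hX hY hc1 hc2 => le_trans ?_ (hC X Y hX hY hc1 hc2)⟩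
  exact_mod_cast totalCount_mono (h ε X Y)

/-- Shell counts of a disjunction (union bound, no finiteness needed). -/
theorem shellCount_or_le (P Q : ℝ → ℝ → BinaryCubic ℤ → ℤ × ℤ → Prop) (X Y : ℝ) (F : BinaryCubic ℤ) :
    shellCount (fun X Y F q => P X Y F q ∨ Q X Y F q) X Y F ≤ shellCount P X Y F + shellCount Q X Y F := by
  unfold shellCount
  have hsplit : {q : ℤ × ℤ | RingOfForm.IsMaximal F ∧ q ∈ ifShell F X Y ∧ (P X Y F q ∨ Q X Y F q)} =
      {q : ℤ × ℤ | RingOfForm.IsMaximal F ∧ q ∈ ifShell F X Y ∧ P X Y F q} ∪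
        {q : ℤ × ℤ | RingOfForm.IsMaximal F ∧ q ∈ ifShell F X Y ∧ Q X Y F q} := by
    ext q; simp only [Set.mem_setOf_eq, Set.mem_union]; tauto
  rw [hsplit]
  exact Set.ncard_union_le _ _

/-- Total counts of a disjunction. -/
theorem totalCount_or_le (P Q : ℝ → ℝ → BinaryCubic ℤ → ℤ × ℤ → Prop) (X Y : ℝ) :
    totalCount (fun X Y F q => P X Y F q ∨ Q X Y F q) X Y ≤ totalCount P X Y + totalCount Q X Y := by
  unfold totalCount
  rw [← Finset.sum_add_distrib]
  exact Finset.sum_le_sum fun D hD => orbitTotal_le_add' (Finset.mem_erase.mp hD).1 fun F => shellCount_or_le P Q X Y F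

/-- Union bound for ε-indexed cone laws with additive constant `1` (constants `max C₁ 0 + max C₂ 0`). -/
theorem lawWithConeE_or {P Q : ℝ → ℝ → ℝ → BinaryCubic ℤ → ℤ × ℤ → Prop} (hP : LawWithConeE P 1)
    (hQ : LawWithConeE Q 1) : LawWithConeE (fun ε X Y F q => P ε X Y F q ∨ Q ε X Y F q) 1 := by
  intro σ hσ ε hε
  obtain ⟨C₁, hC₁⟩ := hP σ hσ ε hε
  obtain ⟨C₂, hC₂⟩ := hQ σ hσ ε hε
  refine ⟨max C₁ 0 + max C₂ 0, fun X Y hX hY hc1 hc2 => ?_⟩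
  have hX0 : 0 < X := by linarith
  have hY0 : 0 < Y := by linarith
  have e₁ := hC₁ X Y hX hY hc1 hc2
  have e₂ := hC₂ X Y hX hY hc1 hc2
  have hsplit : (totalCount (fun X Y F q => P ε X Y F q ∨ Q ε X Y F q) X Y : ℝ) ≤
      (totalCount (P ε) X Y : ℝ) + (totalCount (Q ε) X Y : ℝ) := by
    exact_mod_cast totalCount_or_le (P ε) (Q ε) X Y
  set E : ℝ := (X * Y) ^ ε * (X * Y ^ (-(1 / 6 : ℝ)) + 1) with hE
  have hE0 : 0 ≤ E := by positivity
  calc (totalCount (fun X Y F q => P ε X Y F q ∨ Q ε X Y F q) X Y : ℝ)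
      ≤ (totalCount (P ε) X Y : ℝ) + (totalCount (Q ε) X Y : ℝ) := hsplit
    _ ≤ C₁ * E + C₂ * E := by rw [hE, ← mul_assoc, ← mul_assoc]; exact add_le_add e₁ e₂
    _ ≤ max C₁ 0 * E + max C₂ 0 * E :=
        add_le_add (mul_le_mul_of_nonneg_right (le_max_left _ _) hE0) (mul_le_mul_of_nonneg_right (le_max_left _ _) hE0)
    _ = (max C₁ 0 + max C₂ 0) * (X * Y) ^ ε * (X * Y ^ (-(1 / 6 : ℝ)) + 1) := by rw [hE]; ring

/-- An ε-indexed cone law with additive constant `0` gives the one with constant `1`. -/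
theorem lawWithConeE_one_of_zero {P : ℝ → ℝ → ℝ → BinaryCubic ℤ → ℤ × ℤ → Prop} (hP : LawWithConeE P 0) :
    LawWithConeE P 1 := by
  intro σ hσ ε hε
  obtain ⟨C, hC⟩ := hP σ hσ ε hε
  refine ⟨max C 0, fun X Y hX hY hc1 hc2 => ?_⟩
  have hX0 : 0 < X := by linarith
  have hY0 : 0 < Y := by linarith
  have e := hC X Y hX hY hc1 hc2
  have hE : 0 ≤ (X * Y) ^ ε := Real.rpow_nonneg (by positivity) ε
  have hA : 0 ≤ X * Y ^ (-(1 / 6 : ℝ)) := by positivity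
  calc (totalCount (P ε) X Y : ℝ) ≤ C * (X * Y) ^ ε * (X * Y ^ (-(1 / 6 : ℝ)) + 0) := e
    _ ≤ max C 0 * (X * Y) ^ ε * (X * Y ^ (-(1 / 6 : ℝ)) + 0) :=
        mul_le_mul_of_nonneg_right (mul_le_mul_of_nonneg_right (le_max_left _ _) hE) (by linarith)
    _ ≤ max C 0 * (X * Y) ^ ε * (X * Y ^ (-(1 / 6 : ℝ)) + 1) :=
        mul_le_mul_of_nonneg_left (by linarith) (mul_nonneg (le_max_right _ _) hE)

/-- **v3 cover glue**: the laws on the four v3 populations give the cone index-form shell law. -/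
theorem indexFormShellLawCone_of_flat6Cover (h₁ : LawWithConeE FewDeepFlat6 0) (h₂ : LawWithConeE SpreadDeep6 1)
    (h₃ : LawWithConeE SpreadShallow6 1) (h₄ : LawWithConeE CornerHallTw 1) : IndexFormShellLawCone := by
  have hU : LawWithConeE (fun ε X Y F q =>
      FewDeepFlat6 ε X Y F q ∨ (SpreadDeep6 ε X Y F q ∨ (SpreadShallow6 ε X Y F q ∨ CornerHallTw ε X Y F q))) 1 :=
    lawWithConeE_or (lawWithConeE_one_of_zero h₁) (lawWithConeE_or h₂ (lawWithConeE_or h₃ h₄))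
  have hT : LawWithConeE (fun _ _ _ _ _ => True) 1 :=
    lawWithConeE_mono (fun ε X Y F q _ _ => flat6_cover ε X Y F q) hU
  intro σ hσ ε hε
  exact hT σ hσ ε hε

/-- The v3 cover glue, closed form (registered sub-goal `flat6Cover_glue` of stmt-ABC-1975). -/
theorem flat6Cover_glue : LawWithConeE FewDeepFlat6 0 → LawWithConeE SpreadDeep6 1 → LawWithConeE SpreadShallow6 1 →
    LawWithConeE CornerHallTw 1 → IndexFormShellLawCone :=
  fun h₁ h₂ h₃ h₄ => indexFormShellLawCone_of_flat6Cover h₁ h₂ h₃ h₄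

/-! ## 3. The uniform lever statement and the Hall calibration target -/

/-- **UNIFORM PLANARITY FACTORISATION** (the form of the lever a census over rings can consume): for every
`δ > 0` a constant `C₀ = C₀(δ)` such that for EVERY irreducible maximal `F` there are shape sets `Λ T ⊂ R(F)`
with `#Λ T ≤ C₀·(|a|·|Disc F|·T)^δ·|Cl(R(F))[2]|` and `|Nλ| ≤ C₀·|a|³·|Disc F|⁵·T` on `Λ T`, such that every
coprime `(u,v)` with `F(u,v) ≠ 0` has `r²(au+vω) = λβ²` with `λ ∈ Λ T` (`T, S` the square-free kernel and square
part of the part of `|F(u,v)|` prime to `6·a·Disc F`), `S ∣ Nβ`, and `1 ≤ r ≤ C₀·√|Disc F|`. (Route, all in the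
landed `…PlanarityFactorisation*.lean` machinery: class representatives of norm `≤ M_K√|d_K|` by Minkowski
(`NumberField.exists_ideal_in_class_of_norm_le`), the class of `𝔟` in the `Cl[2]`-coset solving `[𝔟]² = [𝔞']⁻¹`,
bad ideals restricted to SQUARE-FREE products of the `≤ 3ω(6aD)` primes over `6·a·Disc F`, `≤ 3^{ω(T)}` degree-one
choices over `T`, units modulo squares `≤ 2^{rank+1} ≤ 8`; divisor bounds `3^{ω(n)}, 8^{ω(n)} ≪_δ n^δ`.) -/
def PlanarityFactorisationUniform : Prop :=
  ∀ δ : ℝ, 0 < δ → ∃ C₀ : ℝ, 0 < C₀ ∧ ∀ F : BinaryCubic ℤ, F.IsIrreducible → RingOfForm.IsMaximal F →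
    ∃ Λ : ℕ → Finset (RingOfForm F),
      (∀ T : ℕ, ((Λ T).card : ℝ) ≤ C₀ * ((F.a.natAbs : ℝ) * F.disc.natAbs * T) ^ δ * twoTorsionCard F) ∧
      (∀ T : ℕ, ∀ l ∈ Λ T, ((Algebra.norm ℤ l).natAbs : ℝ) ≤
          C₀ * (F.a.natAbs : ℝ) ^ 3 * (F.disc.natAbs : ℝ) ^ 5 * T) ∧
      ∀ u v : ℤ, IsCoprime u v → F.eval u v ≠ 0 →
        ∃ l ∈ Λ (sqfreeKernel (coprimePart (6 * F.a.natAbs * F.disc.natAbs) (F.eval u v).natAbs)),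
          ∃ β : RingOfForm F, ∃ r : ℕ, 1 ≤ r ∧ (r : ℝ) ≤ C₀ * Real.sqrt (F.disc.natAbs : ℝ) ∧
            ((r : RingOfForm F) ^ 2) * planeElt F u v = l * β ^ 2 ∧
            sqPart (coprimePart (6 * F.a.natAbs * F.disc.natAbs) (F.eval u v).natAbs) ∣
              (Algebra.norm ℤ β).natAbs

/-- **Strong Hall near-misses are sparse** (the honest content of the Hall corner at the top of the cone; OPEN,
strictly below the one-variable √-barrier; consistent with Davenport's `deg(u³ − v²) ≥ ½·deg u + 1` for polynomial
families and with Danilov's Pell family, whose ratio tends to `0.97 > 1/72`): the `u ≤ U`, square-free and prime to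
`6`, admitting `v` with `0 < 72·|u³ − v²| ≤ √u`, number `≪_ε U^ε`. Calibration target of `stub_cornerHall`. -/
def StrongHallCount : Prop :=
  ∀ ε : ℝ, 0 < ε → ∃ C : ℝ, ∀ U : ℝ, 1 ≤ U →
    (Set.ncard {q : ℤ × ℤ | 0 < q.1 ∧ (q.1 : ℝ) ≤ U ∧ Squarefree q.1 ∧ IsCoprime q.1 6 ∧ q.1 ^ 3 ≠ q.2 ^ 2 ∧
        (72 * |q.1 ^ 3 - q.2 ^ 2| : ℝ) ≤ Real.sqrt q.1} : ℝ) ≤ C * U ^ ε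

/-! ## 4. The named stub statements and the v3 composition -/

/-- Statement of `stub_fewDeepFlat6`: the companion's few-deep law gives the law on the v3 few-deep population
(no floor: `v(m) ∣ 6·v(m♭⁶)`, so a v3 few-deep datum at budget `X` is syzygy-few-deep at budget `6X`). -/
def FewDeepFlat6Law : Prop := FewDeepLaw → LawWithConeE FewDeepFlat6 0

/-- Statement of `stub_ringCensus` (OPEN): the law on the spread data WITHOUT conic content — a count of
maximal cubic rings (and twists) with a small-height datum, by RADICAL of the discriminant ("+1 per ring"). -/
def RingCensus6 : Prop := LawWithConeE SpreadShallow6 1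

/-- Statement of `stub_cornerHall` (OPEN): the law on the scale-free twist-aware Hall corner. -/
def CornerHallLaw6 : Prop := LawWithConeE CornerHallTw 1

/-- **The v3 composition over named statements**: the BTT uniformity fact (⇒ `FewDeepLaw`, landed
`fewDeepLaw_of_uniformity`), the v3 few-deep step, the spread-deep law (conic census), the spread-shallow law
(ring census) and the Hall law give the crux through the landed cone dictionary and cone transfer. -/
theorem sharpModerateLaw_of_flat6 (hU : Literature.NumberTheory.CubicFields.btt_uniformity_sqDvd)
    (hF : FewDeepFlat6Law) (hD : LawWithConeE SpreadDeep6 1) (hR : RingCensus6) (hH : CornerHallLaw6) :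
    Summit.ABC.ABC.Theses.TwistAmplification.SharpModerateLaw :=
  cuspTransferCone (syzygyTransferCone
    (indexFormShellLawCone_of_flat6Cover (hF (fewDeepLaw_of_uniformity hU)) hD hR hH))

end Summit.ABC.ABC.Theorems.SharpModerateLaw.UnitPlane

end
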